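import Literature.Claims.NS.Moschandreou2024
import Summits.NavierStokesRegularity.NavierStokesRegularity.Theorems.SoloSalvageMoschandreou2024
import Literature.Analysis.FluidPDE.TorusABCFlow
import Mathlib.Analysis.Calculus.Deriv.Abs
import Mathlib.Analysis.SpecialFunctions.Sqrt
import HarnessLib

/-!
# Kernel refutations for `Literature.Claims.NS.Moschandreou2024` (cell `ns-claims`, row C05c)

D-0090 NS-CLAIMS SWEEP, claim C05c (T. E. Moschandreou, *Adv. Pure Math.* 14(9) (2024) 695–743;
skeleton `Literature/Claims/NS/Moschandreou2024.lean`, typist-5 g2, p478433 / rev 2 p478928).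
Refuter of record `ns-claims-refuter-2` (RULINGS v1.29g (2)); the Step 1 / Step 2 kills are
typist-5 g2's kit (`claims/Moschandreou2024/typist5-killkit-…`, adopted unchanged up to
docstrings); the Step 4 / Step 6-lim kills and the NS-slice face of Step 1 are the refuter's. The
principal real Lambert branch (`exists_isPrincipalLambert`, `lambert_apply_branchPoint`), `step_3_holds`,
`step_5_holds` and `not_step_6 : ¬ Step_6` are salvage-p5 g2's `SoloSalvageMoschandreou2024`
(p480830, p481165), imported here.

Main statements (all sorry-free, standard axioms):
* `not_Step_1`, `not_Step_1'` — §6 display after (18), print p.710: `∫_{T³}‖Δb‖² = 0` fails for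
  the ABC flow (`∫‖Δb‖² = 48π⁴`); `laplacianEnergy_ne_zero_along_abcNS` — it fails at every time
  along the exact unforced periodic Navier–Stokes solution `e^{−4π²νt}·abcFlow` (the «NS slices
  only» retype of the referee's menu).
* `not_Step_2`, `not_Step_2sum` — §9 p.716 («pointwise from integrated» / «uncountable sum»).
* `not_Step_4` — §13 p.727 / §16 p.737 / (A2.2) p.743, composition invariance at the grain of
  (43): `v = id` solves `(δ−1)/μ·(v′)² = κ²` with `δ = 2, μ = 1, κ = 1` on `(1,2)`, `W ∘ v = W`
  does not (`W′ = 1/(e^{W}(1+W)) ∈ (0,1)` where differentiable, junk `0` where not).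
* (Step 6 on the real branch, §13 p.727 / §16–§17 p.737, is `not_step_6` of the imported salvage
  file: at `t = 2` the second iterate `W(W(−1/e)) = W(−1)` has already left the real domain.)
* `not_Step_6lim` — the inference schema «true for any n thus in the limit» (p.737):
  `u_n(t) = √((t−1)² + 1/(n+1))` are `C¹` on `[0, n+1)`, converge pointwise to `|t − 1|`, which is
  not `C¹` on `[0,∞)`.
Steps 3, 5 (TRUE, `step_3_holds` / `step_5_holds` of the salvage file), 7 (`step_7_holds`) and 8
(`step_8_iff_claimedTheorem`, the claim itself up to a constant) are not attacked.

WHAT THIS IS NOT: not a claim about NS regularity or blow-up; not a claim about any author beyond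
the typed locator.
-/

set_option linter.dupNamespace false

open MeasureTheory Set Filter UnitAddTorus Topology
open scoped ContDiff Topology

namespace Summit.NavierStokesRegularity.NavierStokesRegularity.Theorems.Moschandreou2024

open Literature.Claims.NS.Moschandreou2024
open Literature.Analysis.FunctionSpaces Literature.Analysis.FluidPDE

noncomputable section

/-! ## Step 1 (§6 display after (18), p.710) — typist-5 g2's kit -/

/-- `∫_{T³} ‖Δ(abcFlow A B C)‖² = (4π²)² (A² + B² + C²)` (the ABC flow is a first-shell Laplacian
eigenfield, `Δb = −4π²b`, `∫‖b‖² = A² + B² + C²`). [cite: MajdaBertozziCUP2002, §2.3.2 Example 2.8] -/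
theorem integral_norm_sq_laplacian_abcFlow (A B C : ℝ) :
    ∫ x, ‖Torus.laplacian (Torus.abcFlow A B C) x‖ ^ 2 =
      (4 * Real.pi ^ 2) ^ 2 * (A ^ 2 + B ^ 2 + C ^ 2) := by
  have h : ∀ x, ‖Torus.laplacian (Torus.abcFlow A B C) x‖ ^ 2 =
      (4 * Real.pi ^ 2) ^ 2 * ‖Torus.abcFlow A B C x‖ ^ 2 := by
    intro x
    rw [Torus.laplacian_abcFlow, norm_neg, norm_smul, mul_pow,
      Real.norm_of_nonneg (by positivity)]
  simp_rw [h]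
  rw [integral_const_mul, Torus.integral_norm_sq_abcFlow]

/-- **Step 1 fails** (§6 display after (18), print p.710): the ABC flow `b = abcFlow 1 1 1` is a
smooth periodic field with `∫_{T³}‖Δb‖² = 48π⁴ ≠ 0`. (typist-5 g2's kit.)
[cite: Moschandreou2024b, §6 display after (18) p.710] -/
theorem not_Step_1 : ¬ Literature.Claims.NS.Moschandreou2024.Step_1 := by
  intro h
  have h1 := h (Torus.abcFlow 1 1 1) (Torus.isSmooth_abcFlow 1 1 1)
  rw [integral_norm_sq_laplacian_abcFlow] at h1
  have : (0 : ℝ) < (4 * Real.pi ^ 2) ^ 2 * (1 ^ 2 + 1 ^ 2 + 1 ^ 2) := by positivity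
  linarith

/-- **Step 1′ fails** on the restricted class (divergence free, mean zero) with the same witness.
(typist-5 g2's kit.) [cite: Moschandreou2024b, §6 display after (18) p.710 with §5 p.709] -/
theorem not_Step_1' : ¬ Literature.Claims.NS.Moschandreou2024.Step_1' := by
  intro h
  have h1 := h (Torus.abcFlow 1 1 1) (Torus.isSmooth_abcFlow 1 1 1) (Torus.isDivFree_abcFlow 1 1 1)
    (Torus.hasZeroMean_abcFlow 1 1 1)
  rw [integral_norm_sq_laplacian_abcFlow] at h1
  have : (0 : ℝ) < (4 * Real.pi ^ 2) ^ 2 * (1 ^ 2 + 1 ^ 2 + 1 ^ 2) := by positivity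
  linarith

/-- **Step 1 fails along an exact unforced periodic Navier–Stokes flow, at every time** (the «NS
slices only» charitable retype): for the viscous ABC solution `u(t) = e^{−4π²νt}·abcFlow 1 1 1`
(`Torus.isClassicalNSSolutionOn_abcFlow`, force `0`, any `ν`), `∫_{T³}‖Δu(t)‖² = 48π⁴e^{−8π²νt} ≠ 0`.
[cite: Moschandreou2024b, §6 display after (18) p.710 with §5 p.709 («mean zero solutions»)]
[cite: MajdaBertozziCUP2002, §2.3.2 p. 61] -/
theorem laplacianEnergy_ne_zero_along_abcNS (ν t : ℝ) :
    ∫ x, ‖Torus.laplacian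
        (fun x => Real.exp (-(ν * (2 * Real.pi) ^ 2) * t) • Torus.abcFlow 1 1 1 x) x‖ ^ 2 ≠ 0 := by
  set c : ℝ := Real.exp (-(ν * (2 * Real.pi) ^ 2) * t) with hc
  have hcpos : 0 < c := Real.exp_pos _
  have h1 : ∀ j, Torus.abcAmp 1 1 1 j = 1 := by
    intro j
    fin_cases j <;> simp [Torus.abcAmp]
  have h2 : ∀ j, Torus.abcAmp c c c j = c := by
    intro j
    fin_cases j <;> simp [Torus.abcAmp]
  have hfun : (fun x => c • Torus.abcFlow 1 1 1 x) = Torus.abcFlow c c c := by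
    funext x
    ext i
    rw [PiLp.smul_apply, smul_eq_mul, Torus.abcFlow_apply, Torus.abcFlow_apply, h1, h1, h2, h2]
    ring
  rw [hfun, integral_norm_sq_laplacian_abcFlow]
  positivity

/-! ## Step 2 (§9 pp.715–716) — typist-5 g2's kit -/

/-- **Step 2 fails** (§9 p.716): `g(x) = Re e^{2πi x₀} = cos(2πx₀)` is continuous on `T³`, has
integral `0`, and `g(0) = 1`. (typist-5 g2's kit.) [cite: Moschandreou2024b, §9 after (29) p.716] -/
theorem not_Step_2 : ¬ Literature.Claims.NS.Moschandreou2024.Step_2 := by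
  intro h
  set n : Fin 3 → ℤ := Pi.single 0 1 with hn
  have hn0 : n ≠ 0 := by
    intro h0
    have := congr_fun h0 0
    simp [hn] at this
  let g : UnitAddTorus (Fin 3) → ℝ := fun x => (mFourier n x).re
  have hg : Continuous g := Complex.continuous_re.comp (mFourier n).continuous
  have hint : ∫ x, g x = 0 := by
    have hI : Integrable (fun x : UnitAddTorus (Fin 3) => mFourier n x) volume :=
      (mFourier n).continuous.integrable_unitAddTorus
    have h1 : ∫ x, g x = (∫ x, mFourier n x).re := by
      simpa [g] using (integral_re hI)
    rw [h1, Torus.integral_mFourier, if_neg hn0]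
    simp
  have h0 := h g hg hint 0
  have : g 0 = 1 := by
    simp [g, mFourier]
  rw [this] at h0
  exact one_ne_zero h0

/-- **Step 2 (uncountable-sum reading) fails** (§9 p.716): the family `±1` on two points of `T³`
sums to `0`. (typist-5 g2's kit.) [cite: Moschandreou2024b, §9 after (29) p.716] -/
theorem not_Step_2sum : ¬ Literature.Claims.NS.Moschandreou2024.Step_2sum := by
  intro h
  classical
  obtain ⟨a, b, hab⟩ : ∃ a b : UnitAddTorus (Fin 3), a ≠ b := by
    refine ⟨0, fun _ => ((1 / 2 : ℝ) : UnitAddCircle), ?_⟩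
    intro h0
    have h1 := congr_fun h0 0
    simp only [Pi.zero_apply] at h1
    have h2 : ((1 / 2 : ℝ) : AddCircle (1 : ℝ)) = 0 := h1.symm
    obtain ⟨k, hk⟩ := (AddCircle.coe_eq_zero_iff (p := (1 : ℝ))).mp h2
    rw [zsmul_eq_mul, mul_one] at hk
    have h3 : ((2 * k : ℤ) : ℝ) = ((1 : ℤ) : ℝ) := by
      push_cast
      linarith
    have h4 : 2 * k = 1 := Int.cast_inj.mp h3
    omega
  let g : UnitAddTorus (Fin 3) → ℝ := fun x => if x = a then 1 else if x = b then -1 else 0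
  have hsum : HasSum g 0 := by
    have hsupp : ∀ x ∉ ({a, b} : Finset (UnitAddTorus (Fin 3))), g x = 0 := by
      intro x hx
      simp only [Finset.mem_insert, Finset.mem_singleton, not_or] at hx
      simp [g, hx.1, hx.2]
    have : HasSum g (∑ x ∈ ({a, b} : Finset (UnitAddTorus (Fin 3))), g x) :=
      hasSum_sum_of_ne_finset_zero hsupp
    have hval : ∑ x ∈ ({a, b} : Finset (UnitAddTorus (Fin 3))), g x = 0 := by
      rw [Finset.sum_pair hab]
      simp [g, hab.symm]
    rwa [hval] at this
  have := h g hsum a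
  simp [g] at this

/-! ## Step 4 (§13 p.727 / §16 p.737 / (A2.2) p.743) — composition with `W` does not preserve (43) -/

/-- A principal real Lambert function is positive at positive arguments (`W e^{W} = x > 0`).
[folklore] -/
theorem lambert_pos {W : ℝ → ℝ} (hW : IsPrincipalLambert W) {x : ℝ} (hx : 0 < x) :
    0 < W x := by
  have hx' : -Real.exp (-1) ≤ x := by linarith [Real.exp_pos (-1)]
  have h := (hW x hx').2
  by_contra hle
  nlinarith [Real.exp_pos (W x), not_lt.mp hle]

/-- **Step 4 fails**: with `δ = 2`, `μ = 1`, `κ = 1` the function `v = id` solves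
`(δ−1)/μ·(v′)² = κ²` on `(1, 2)` and stays in `W`'s domain, but `W ∘ v = W` does not solve it at
`s = 3/2`: where `W` is differentiable, differentiating `W e^{W} = id` gives
`W′·e^{W}(1 + W) = 1` with `W(3/2) > 0`, so `0 < W′ < 1`; where it is not, `deriv` is `0`.
[cite: Moschandreou2024b, §13 p.727; §16 p.737; §14 (43)–(44) pp.730–731; App. 2 (A2.2) p.743] -/
theorem not_Step_4 : ¬ Literature.Claims.NS.Moschandreou2024.Step_4 := by
  intro h
  obtain ⟨W, hW⟩ := exists_isPrincipalLambert
  have hdom : ∀ s ∈ Ioo (1 : ℝ) 2, -Real.exp (-1) < id s := by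
    intro s hs
    have := Real.exp_pos (-1)
    simp only [id]
    linarith [hs.1]
  have hode : ∀ s ∈ Ioo (1 : ℝ) 2, (2 - 1) / 1 * deriv id s ^ 2 = (1 : ℝ) ^ 2 := by
    intro s _
    norm_num [deriv_id]
  have hs : (3 / 2 : ℝ) ∈ Ioo (1 : ℝ) 2 := by constructor <;> norm_num
  have h4 := h W hW 2 1 1 (by norm_num) one_pos 1 2 (by norm_num) id differentiableOn_id hdom hode
    (3 / 2) hs
  have hsq' : deriv W (3 / 2) ^ 2 = 1 := by
    rw [Function.comp_id] at h4
    linarith [h4]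
  have hsq : deriv W (3 / 2) = 1 ∨ deriv W (3 / 2) = -1 := by
    have hfac : (deriv W (3 / 2) - 1) * (deriv W (3 / 2) + 1) = 0 := by nlinarith [hsq']
    rcases mul_eq_zero.mp hfac with h0 | h0
    · exact Or.inl (by linarith)
    · exact Or.inr (by linarith)
  by_cases hd : DifferentiableAt ℝ W (3 / 2)
  · have hwpos : 0 < W (3 / 2) := lambert_pos hW (by norm_num)
    have hder : HasDerivAt W (deriv W (3 / 2)) (3 / 2) := hd.hasDerivAt
    have hprod : HasDerivAt (fun x => W x * Real.exp (W x))
        (deriv W (3 / 2) * Real.exp (W (3 / 2)) +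
          W (3 / 2) * (Real.exp (W (3 / 2)) * deriv W (3 / 2))) (3 / 2) :=
      hder.fun_mul hder.exp
    have hev : (fun x => W x * Real.exp (W x)) =ᶠ[𝓝 (3 / 2 : ℝ)] id := by
      have hmem : Ioi (-Real.exp (-1)) ∈ 𝓝 (3 / 2 : ℝ) :=
        Ioi_mem_nhds (by linarith [Real.exp_pos (-1)])
      filter_upwards [hmem] with x hx
      exact (hW x (le_of_lt hx)).2
    have h1 : deriv W (3 / 2) * Real.exp (W (3 / 2)) +
        W (3 / 2) * (Real.exp (W (3 / 2)) * deriv W (3 / 2)) = 1 := by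
      rw [← hprod.deriv, hev.deriv_eq, deriv_id]
    have hexp : 1 < Real.exp (W (3 / 2)) := Real.one_lt_exp_iff.mpr hwpos
    have hwe : 0 < W (3 / 2) * Real.exp (W (3 / 2)) := mul_pos hwpos (Real.exp_pos _)
    rcases hsq with hd1 | hd1
    · rw [hd1] at h1
      nlinarith
    · rw [hd1] at h1
      nlinarith [Real.exp_pos (W (3 / 2))]
  · rw [deriv_zero_of_not_differentiableAt hd] at hsq
    norm_num at hsq

/-! ## Step 6, inference-schema reading (§16–§17 p.737) -/

/-- **Step 6 (inference schema «true for any n thus in the limit») fails**: `u_n(t) =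
√((t−1)² + 1/(n+1))` is `C¹` (indeed smooth) on `[0, n+1)`, `n + 1 → ∞`, `u_n(t) → |t − 1|`
pointwise, and `t ↦ |t − 1|` is not `C¹` on `[0, ∞)` (not differentiable at `t = 1`).
[cite: Moschandreou2024b, §16 p.737; §17 p.737] -/
theorem not_Step_6lim : ¬ Literature.Claims.NS.Moschandreou2024.Step_6lim := by
  intro h
  have hpos : ∀ (n : ℕ) (t : ℝ), (t - 1) ^ 2 + 1 / ((n : ℝ) + 1) ≠ 0 := by
    intro n t
    have : (0 : ℝ) < 1 / ((n : ℝ) + 1) := by positivity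
    positivity
  have hv := h (fun n t => Real.sqrt ((t - 1) ^ 2 + 1 / ((n : ℝ) + 1))) (fun n => (n : ℝ) + 1)
    (fun t => |t - 1|) (tendsto_natCast_atTop_atTop.atTop_add tendsto_const_nhds) ?_ ?_
  · have hd : DifferentiableAt ℝ (fun t : ℝ => |t - 1|) 1 :=
      hv.differentiableOn_one.differentiableAt (Ici_mem_nhds (by norm_num))
    have hcomp : DifferentiableAt ℝ ((fun t : ℝ => |t - 1|) ∘ fun t : ℝ => t + 1) 0 := by
      refine DifferentiableAt.comp (0 : ℝ) ?_ (differentiableAt_id.add_const 1)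
      simpa using hd
    have heq : ((fun t : ℝ => |t - 1|) ∘ fun t : ℝ => t + 1) = (abs : ℝ → ℝ) := by
      funext t
      simp
    rw [heq] at hcomp
    exact not_differentiableAt_abs_zero hcomp
  · intro n
    have hc : ContDiff ℝ 1 (fun t : ℝ => (t - 1) ^ 2 + 1 / ((n : ℝ) + 1)) :=
      ((contDiff_id.sub contDiff_const).pow 2).add contDiff_const
    exact (hc.sqrt (hpos n)).contDiffOn
  · intro t _
    have hlim : Tendsto (fun n : ℕ => (t - 1) ^ 2 + 1 / ((n : ℝ) + 1)) atTop
        (𝓝 ((t - 1) ^ 2 + 0)) :=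
      tendsto_const_nhds.add tendsto_one_div_add_atTop_nhds_zero_nat
    have := hlim.sqrt
    rw [add_zero, Real.sqrt_sq_eq_abs] at this
    exact this

end

end Summit.NavierStokesRegularity.NavierStokesRegularity.Theorems.Moschandreou2024
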